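import Literature.NumberTheory.Transcendental.RoySmallValueFactors
import Literature.NumberTheory.Transcendental.RoySmallValueAnalytic
import Mathlib.Analysis.Complex.Polynomial.Basic
import HarnessLib

/-!
# Roy's small value estimate for `𝔾ₐ × 𝔾ₘ` — linear non-zero-divisors modulo `(P, Q)`

Topic `Literature/NumberTheory/Transcendental`. Part of the formalisation of the proof of Roy 2013,
Theorem 1.1 (named fact `roy2013_thm_1_1`, `RoySmallValueEstimates.lean`). Source: D. Roy,
*A small value estimate for `𝔾ₐ × 𝔾ₘ`*, Mathematika 59 (2013) 333–363 = arXiv:1301.0663, §5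
(p. 13 of the arXiv text):

> Suppose that a subsequence `(P₁, …, P_t)` of `(P₀, …, Pₘ)` is a regular sequence [...] which,
> for homogeneous polynomials, is equivalent to asking that `dim Z(P₁, …, P_t) = m − t`.

The paper uses freely (here and in §6, where `Z(P, Q)` "has dimension `0`" and the resultant
`Res_D(P, Q, R)` vanishes exactly when `R` meets `Z(P, Q)`) the unmixedness theorem: a form with no
zero on `Z(P₁, …, P_t)` is a non-zero-divisor modulo `(P₁, …, P_t)`. Mathlib has no Cohen–Macaulay
theory; this file proves the first, elementary, step of a direct proof for two ternary forms
`P, Q`: **a linear form `h = X₀ − aX₁ − bX₂` with no zero on `Z(P, Q)` is a non-zero-divisor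
modulo `(P, Q)`** (`lineForm_mul_mem_span_pair`), by restriction to the line `h = 0`: the
substitution `θ : X₀ ↦ aX₁ + bX₂` (`theta`) has kernel `(h)`, the restrictions `θP, θQ` are coprime
binary forms (a common factor would have a zero on the line, `exists_zero_dir_of_theta_eq`, giving
a common zero of `P, Q, h`), and a relation `uP + vQ = hf` restricts to a Koszul relation
`ū θP + v̄ θQ = 0`, which lifts. Everything here is proved; no named facts.

## References

* [Roy2013] D. Roy, *A small value estimate for 𝔾ₐ × 𝔾ₘ*, Mathematika 59 (2013), 333–363
  (arXiv:1301.0663), §5 (regular sequences of forms) and §6 (proof of Proposition 6.4).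
-/

noncomputable section

open MvPolynomial Finset

namespace Literature.NumberTheory.Transcendental

namespace Roy2013

/-! ### The restriction `θ` to the line `X₀ = aX₁ + bX₂` -/

/-- The substitution `θ_{a,b} : X₀ ↦ aX₁ + bX₂` (restriction to the line `h = 0` followed by the
cone over it). [cite: Roy2013, §5 (regular sequences)] -/
def theta (a b : ℂ) : CX →ₐ[ℂ] CX := aeval ![C a * X 1 + C b * X 2, X 1, X 2]

/-- The linear form `h = X₀ − aX₁ − bX₂`. [cite: Roy2013, §5 (regular sequences)] -/
def lineForm (a b : ℂ) : CX := X 0 - (C a * X 1 + C b * X 2)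

variable (a b : ℂ)

/-- `θ(X₀) = aX₁ + bX₂`. [folklore] -/
@[simp] theorem theta_X_zero : theta a b (X 0) = C a * X 1 + C b * X 2 := by simp [theta]

/-- `θ(X₁) = X₁`. [folklore] -/
@[simp] theorem theta_X_one : theta a b (X 1) = X 1 := by simp [theta]

/-- `θ(X₂) = X₂`. [folklore] -/
@[simp] theorem theta_X_two : theta a b (X 2) = X 2 := by simp [theta]

/-- `θ` fixes constants. [folklore] -/
@[simp] theorem theta_C (c : ℂ) : theta a b (C c) = C c := by simp [theta]

/-- `θ(h) = 0`. [folklore] -/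
@[simp] theorem theta_lineForm : theta a b (lineForm a b) = 0 := by
  simp [lineForm, map_sub, map_add, map_mul]

/-- `θ` is idempotent. [folklore] -/
theorem theta_theta (f : CX) : theta a b (theta a b f) = theta a b f := by
  have h : (theta a b).comp (theta a b) = theta a b := by
    refine MvPolynomial.algHom_ext fun i => ?_
    fin_cases i <;> simp [map_add, map_mul]
  exact congrArg (fun φ : CX →ₐ[ℂ] CX => φ f) h

/-- `h ∣ f − θ(f)`. [folklore] -/
theorem lineForm_dvd_sub_theta (f : CX) : lineForm a b ∣ f - theta a b f := by
  induction f using MvPolynomial.induction_on with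
  | C c => simp
  | add p q hp hq =>
    have : p + q - theta a b (p + q) = (p - theta a b p) + (q - theta a b q) := by
      rw [map_add]; ring
    rw [this]; exact dvd_add hp hq
  | mul_X p i hp =>
    have : p * X i - theta a b (p * X i) =
        (p - theta a b p) * X i + theta a b p * (X i - theta a b (X i)) := by
      rw [map_mul]; ring
    rw [this]
    refine dvd_add (dvd_mul_of_dvd_left hp _) (dvd_mul_of_dvd_right ?_ _)
    fin_cases i
    · exact ⟨1, by simp [lineForm]⟩
    · simp
    · simp

/-- **`ker θ = (h)`.** [folklore] -/
theorem theta_eq_zero_iff (f : CX) : theta a b f = 0 ↔ lineForm a b ∣ f := by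
  constructor
  · intro h
    have h1 := lineForm_dvd_sub_theta a b f
    rwa [h, sub_zero] at h1
  · rintro ⟨g, rfl⟩
    rw [map_mul, theta_lineForm, zero_mul]

/-- Evaluating a substitution. [folklore] -/
theorem eval_aeval_self (g : Fin 3 → CX) (x : Fin 3 → ℂ) (f : CX) :
    eval x (aeval g f) = eval (fun i => eval x (g i)) f := by
  induction f using MvPolynomial.induction_on with
  | C c => simp
  | add p q hp hq => rw [map_add, map_add, hp, hq, map_add]
  | mul_X p i hp => rw [map_mul, map_mul, hp, map_mul, aeval_X, eval_X]

/-- `θ(f)(x) = f(ax₁ + bx₂, x₁, x₂)`. [folklore] -/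
theorem eval_theta (x : Fin 3 → ℂ) (f : CX) :
    eval x (theta a b f) = eval ![a * x 1 + b * x 2, x 1, x 2] f := by
  rw [theta, eval_aeval_self]
  have h : (fun i => eval x ((![C a * X 1 + C b * X 2, X 1, X 2] : Fin 3 → CX) i)) =
      ![a * x 1 + b * x 2, x 1, x 2] := by
    funext i
    fin_cases i <;> simp
  rw [h]

/-- `θ` preserves forms. [folklore] -/
theorem isHomogeneous_theta {f : CX} {n : ℕ} (hf : f.IsHomogeneous n) :
    (theta a b f).IsHomogeneous n := by
  have hg : ∀ i : Fin 3, ((![C a * X 1 + C b * X 2, X 1, X 2] : Fin 3 → CX) i).IsHomogeneous 1 := by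
    intro i
    fin_cases i
    · exact ((isHomogeneous_X _ _).C_mul _).add ((isHomogeneous_X _ _).C_mul _)
    · exact isHomogeneous_X _ _
    · exact isHomogeneous_X _ _
  have h := hf.eval₂ (algebraMap ℂ CX) ![C a * X 1 + C b * X 2, X 1, X 2]
    (fun r => isHomogeneous_C _ _) hg
  rw [one_mul] at h
  rw [theta, aeval_def]
  exact h

/-- `h(α) = α₀ − aα₁ − bα₂`. [folklore] -/
theorem eval_lineForm (x : Fin 3 → ℂ) : eval x (lineForm a b) = x 0 - (a * x 1 + b * x 2) := by
  simp [lineForm]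

/-- `h ≠ 0`. [folklore] -/
theorem lineForm_ne_zero : lineForm a b ≠ 0 := by
  intro h
  have h1 := congrArg (eval ![(1 : ℂ), 0, 0]) h
  rw [eval_lineForm, map_zero] at h1
  simp only [Matrix.cons_val_zero, Matrix.cons_val_one, Matrix.head_cons, Matrix.cons_val_two,
    Matrix.tail_cons, mul_zero, add_zero, sub_zero] at h1
  exact one_ne_zero h1

/-! ### Binary forms have zeros -/

/-- A `θ`-fixed form depends only on `(x₁, x₂)`. [folklore] -/
theorem eval_eq_of_theta_eq {g : CX} (hg : theta a b g = g) (x₀ x₁ x₂ : ℂ) :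
    eval ![x₀, x₁, x₂] g = eval ![a * x₁ + b * x₂, x₁, x₂] g := by
  conv_lhs => rw [← hg, eval_theta]
  simp

/-- **A non-constant binary form over `ℂ` has a projective zero**: a `θ`-fixed form `g` of degree
`d ≥ 1` vanishes identically in some direction `(·, β₁, β₂)`, `(β₁, β₂) ≠ 0`. [folklore] -/
theorem exists_zero_dir_of_theta_eq {g : CX} (hg : theta a b g = g) {d : ℕ}
    (hgd : g.IsHomogeneous d) (hd : 1 ≤ d) :
    ∃ β₁ β₂ : ℂ, (β₁ ≠ 0 ∨ β₂ ≠ 0) ∧ ∀ x₀ : ℂ, eval ![x₀, β₁, β₂] g = 0 := by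
  have key := eval_eq_of_theta_eq a b hg
  -- `q(t) = g(·, t, 1)`
  set q : Polynomial ℂ := MvPolynomial.eval₂ Polynomial.C ![0, Polynomial.X, Polynomial.C 1] g
    with hq
  have hqe : ∀ t : ℂ, q.eval t = eval ![0, t, 1] g := by
    intro t
    rw [hq, ← Polynomial.coe_evalRingHom, MvPolynomial.eval₂_comp_left]
    rw [show (Polynomial.evalRingHom t).comp Polynomial.C = RingHom.id ℂ from
      RingHom.ext fun r => Polynomial.eval_C]
    change MvPolynomial.eval₂ (RingHom.id ℂ) _ g = MvPolynomial.eval₂ (RingHom.id ℂ) _ g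
    congr 1
    funext i; fin_cases i <;> simp
  by_cases hdeg : 0 < q.degree
  · obtain ⟨t₀, ht₀⟩ := Complex.exists_root hdeg
    refine ⟨t₀, 1, Or.inr one_ne_zero, fun x₀ => ?_⟩
    rw [key, ← key 0, ← hqe]; exact ht₀
  · have hqC := Polynomial.eq_C_of_degree_le_zero (not_lt.mp hdeg)
    by_cases hc : q.coeff 0 = 0
    · refine ⟨0, 1, Or.inr one_ne_zero, fun x₀ => ?_⟩
      rw [key, ← key 0, ← hqe, hqC, hc, map_zero, Polynomial.eval_zero]
    · -- `g(0, 1, s) = c s^d` for `s ≠ 0`, hence `g(0, 1, 0) = 0`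
      set r : Polynomial ℂ := MvPolynomial.eval₂ Polynomial.C ![0, Polynomial.C 1, Polynomial.X] g
        with hr
      have hre : ∀ s : ℂ, r.eval s = eval ![0, 1, s] g := by
        intro s
        rw [hr, ← Polynomial.coe_evalRingHom, MvPolynomial.eval₂_comp_left]
        rw [show (Polynomial.evalRingHom s).comp Polynomial.C = RingHom.id ℂ from
          RingHom.ext fun r => Polynomial.eval_C]
        change MvPolynomial.eval₂ (RingHom.id ℂ) _ g = MvPolynomial.eval₂ (RingHom.id ℂ) _ g
        congr 1
        funext i; fin_cases i <;> simp
      have hrs : ∀ s : ℂ, s ≠ 0 → r.eval s = q.coeff 0 * s ^ d := by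
        intro s hs
        have hsm : (![0, 1, s] : Fin 3 → ℂ) = s • ![0, s⁻¹, 1] := by
          funext i; fin_cases i <;> simp [hs]
        have h1 : eval (s • ![0, s⁻¹, 1]) g = s ^ d * eval ![0, s⁻¹, 1] g :=
          aeval_smul_of_isHomogeneous hgd s ![0, s⁻¹, 1]
        rw [← hsm] at h1
        rw [hre, h1, ← hqe, hqC, Polynomial.eval_C, Polynomial.coeff_C_zero, mul_comm]
      have hrpoly : r = Polynomial.C (q.coeff 0) * Polynomial.X ^ d := by
        refine sub_eq_zero.mp (Polynomial.eq_zero_of_infinite_isRoot _ ?_)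
        refine Set.Infinite.mono (s := {s : ℂ | s ≠ 0}) (fun s hs => ?_)
          (Set.infinite_of_finite_compl (by simp))
        simp only [Set.mem_setOf_eq, Polynomial.IsRoot.def, Polynomial.eval_sub,
          Polynomial.eval_mul, Polynomial.eval_C, Polynomial.eval_pow, Polynomial.eval_X]
        rw [hrs s hs, sub_self]
      refine ⟨1, 0, Or.inl one_ne_zero, fun x₀ => ?_⟩
      rw [key, ← key 0, ← hre, hrpoly]
      simp [zero_pow (by omega : d ≠ 0)]

/-! ### Coprimality of the restrictions -/

/-- If `P, Q, h` have no common projective zero and `θQ` is a non-zero form of degree `≥ 1` (or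
zero), then `θP ≠ 0`. [cite: Roy2013, §5 (regular sequences); elementary] -/
theorem theta_ne_zero_of_no_common_zero {P Q : CX} {D : ℕ} (hQ : Q.IsHomogeneous D) (hD : 1 ≤ D)
    (hV : ∀ α : Fin 3 → ℂ, α ≠ 0 → eval α P = 0 → eval α Q = 0 → eval α (lineForm a b) ≠ 0) :
    theta a b P ≠ 0 := by
  intro hP0
  -- a zero direction of `θQ` on the line (any direction if `θQ = 0`)
  obtain ⟨β₁, β₂, hβ, hzero⟩ : ∃ β₁ β₂ : ℂ, (β₁ ≠ 0 ∨ β₂ ≠ 0) ∧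
      ∀ x₀ : ℂ, eval ![x₀, β₁, β₂] (theta a b Q) = 0 := by
    by_cases hQ0 : theta a b Q = 0
    · exact ⟨1, 0, Or.inl one_ne_zero, fun x₀ => by rw [hQ0, map_zero]⟩
    · exact exists_zero_dir_of_theta_eq a b (theta_theta a b Q) (isHomogeneous_theta a b hQ) hD
  refine hV ![a * β₁ + b * β₂, β₁, β₂] ?_ ?_ ?_ ?_
  · intro h
    rcases hβ with h1 | h1
    · exact h1 (by simpa using congr_fun h 1)
    · exact h1 (by simpa using congr_fun h 2)
  · have h := eval_theta a b ![a * β₁ + b * β₂, β₁, β₂] P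
    simp only [Matrix.cons_val_one, Matrix.cons_val_zero, Matrix.head_cons,
      Matrix.cons_val_two, Matrix.tail_cons] at h
    rw [← h, hP0, map_zero]
  · have h := eval_theta a b ![a * β₁ + b * β₂, β₁, β₂] Q
    simp only [Matrix.cons_val_one, Matrix.cons_val_zero, Matrix.head_cons,
      Matrix.cons_val_two, Matrix.tail_cons] at h
    rw [← h]; exact hzero _
  · simp [eval_lineForm]

/-- **The restrictions `θP, θQ` are coprime** when `P, Q, h` have no common projective zero.
[cite: Roy2013, §5 (regular sequences); elementary] -/
theorem isRelPrime_theta {P Q : CX} {D : ℕ} (hP : P.IsHomogeneous D) (hQ : Q.IsHomogeneous D)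
    (hD : 1 ≤ D)
    (hV : ∀ α : Fin 3 → ℂ, α ≠ 0 → eval α P = 0 → eval α Q = 0 → eval α (lineForm a b) ≠ 0) :
    IsRelPrime (theta a b P) (theta a b Q) := by
  have hPne : theta a b P ≠ 0 := theta_ne_zero_of_no_common_zero a b hQ hD hV
  intro g hgP hgQ
  by_contra hu
  have hg0 : g ≠ 0 := fun h => hPne (by obtain ⟨u, hu⟩ := hgP; rw [hu, h, zero_mul])
  -- `g` is a form of degree `e ≥ 1`
  have hge : g.IsHomogeneous g.totalDegree :=
    isHomogeneous_of_dvd (isHomogeneous_theta a b hP) hPne hgP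
  have he : 1 ≤ g.totalDegree := by
    by_contra he
    have hgC := totalDegree_eq_zero_iff_eq_C.mp (by omega : g.totalDegree = 0)
    apply hu
    rw [hgC]
    refine isUnit_iff_exists_inv.mpr ⟨C (coeff 0 g)⁻¹, ?_⟩
    rw [← C_mul, mul_inv_cancel₀ (fun h0 => hg0 (by rw [hgC, h0, C_0])), C_1]
  -- `g' = θ g` is a nonzero `θ`-fixed form dividing `θP, θQ`
  have hg'P : theta a b g ∣ theta a b P := by
    have h := map_dvd (theta a b) hgP; rwa [theta_theta] at h
  have hg'Q : theta a b g ∣ theta a b Q := by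
    have h := map_dvd (theta a b) hgQ; rwa [theta_theta] at h
  obtain ⟨β₁, β₂, hβ, hzero⟩ := exists_zero_dir_of_theta_eq a b (theta_theta a b g)
    (isHomogeneous_theta a b hge) he
  refine hV ![a * β₁ + b * β₂, β₁, β₂] ?_ ?_ ?_ ?_
  · intro h
    rcases hβ with h1 | h1
    · exact h1 (by simpa using congr_fun h 1)
    · exact h1 (by simpa using congr_fun h 2)
  · have h := eval_theta a b ![a * β₁ + b * β₂, β₁, β₂] P
    simp only [Matrix.cons_val_one, Matrix.cons_val_zero, Matrix.head_cons,
      Matrix.cons_val_two, Matrix.tail_cons] at h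
    obtain ⟨u, hu'⟩ := hg'P
    rw [← h, hu', map_mul, hzero, zero_mul]
  · have h := eval_theta a b ![a * β₁ + b * β₂, β₁, β₂] Q
    simp only [Matrix.cons_val_one, Matrix.cons_val_zero, Matrix.head_cons,
      Matrix.cons_val_two, Matrix.tail_cons] at h
    obtain ⟨u, hu'⟩ := hg'Q
    rw [← h, hu', map_mul, hzero, zero_mul]
  · simp [eval_lineForm]

/-! ### `h` is a non-zero-divisor modulo `(P, Q)` -/

/-- **A linear form with no zero on `Z(P, Q)` is a non-zero-divisor modulo `(P, Q)`** (`P, Q`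
ternary forms of degree `D ≥ 1`): `h f ∈ (P, Q) ⇒ f ∈ (P, Q)`.
[cite: Roy2013, §5 ("equivalent to asking that `dim Z(P₁,…,P_t) = m − t`"); elementary proof] -/
theorem lineForm_mul_mem_span_pair {P Q : CX} {D : ℕ} (hP : P.IsHomogeneous D)
    (hQ : Q.IsHomogeneous D) (hD : 1 ≤ D)
    (hV : ∀ α : Fin 3 → ℂ, α ≠ 0 → eval α P = 0 → eval α Q = 0 → eval α (lineForm a b) ≠ 0)
    {f : CX} (hf : lineForm a b * f ∈ Ideal.span {P, Q}) : f ∈ Ideal.span {P, Q} := by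
  obtain ⟨u, v, huv⟩ := Ideal.mem_span_pair.mp hf
  have hQne : theta a b Q ≠ 0 :=
    theta_ne_zero_of_no_common_zero a b hP hD (fun α hα h1 h2 => hV α hα h2 h1)
  have hcop : IsRelPrime (theta a b Q) (theta a b P) := (isRelPrime_theta a b hP hQ hD hV).symm
  -- restrict the relation to the line: `θu θP + θv θQ = 0`
  have hrel : theta a b u * theta a b P + theta a b v * theta a b Q = 0 := by
    have h := congrArg (theta a b) huv
    rwa [map_add, map_mul, map_mul, map_mul, theta_lineForm, zero_mul] at h
  -- Koszul: `θu = c θQ`, `θv = −c θP` with `θ c = c`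
  obtain ⟨c, hc⟩ : theta a b Q ∣ theta a b u :=
    hcop.dvd_of_dvd_mul_right ⟨-theta a b v, by linear_combination hrel⟩
  have hcc : theta a b c = c := by
    have h := congrArg (theta a b) hc
    rw [theta_theta, map_mul, theta_theta, hc] at h
    exact (mul_left_cancel₀ hQne h).symm
  have hv : theta a b v = -(c * theta a b P) := by
    have h : theta a b Q * (theta a b v + c * theta a b P) = 0 := by
      linear_combination hrel - theta a b P * hc
    rcases mul_eq_zero.mp h with h | h
    · exact absurd h hQne
    · linear_combination h
  -- lift
  have hu' : lineForm a b ∣ u - c * Q := by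
    rw [← theta_eq_zero_iff, map_sub, map_mul, hcc, hc]; ring
  have hv' : lineForm a b ∣ v + c * P := by
    rw [← theta_eq_zero_iff, map_add, map_mul, hcc, hv]; ring
  obtain ⟨u'', hu''⟩ := hu'
  obtain ⟨v'', hv''⟩ := hv'
  have hkey : lineForm a b * (u'' * P + v'' * Q) = lineForm a b * f := by
    have e1 : u = lineForm a b * u'' + c * Q := by linear_combination hu''
    have e2 : v = lineForm a b * v'' - c * P := by linear_combination hv''
    rw [← huv, e1, e2]; ring
  rw [← mul_left_cancel₀ (lineForm_ne_zero a b) hkey]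
  exact Ideal.mem_span_pair.mpr ⟨u'', v'', rfl⟩

/-- Powers of `h` are non-zero-divisors modulo `(P, Q)` as well. [folklore] -/
theorem lineForm_pow_mul_mem_span_pair {P Q : CX} {D : ℕ} (hP : P.IsHomogeneous D)
    (hQ : Q.IsHomogeneous D) (hD : 1 ≤ D)
    (hV : ∀ α : Fin 3 → ℂ, α ≠ 0 → eval α P = 0 → eval α Q = 0 → eval α (lineForm a b) ≠ 0)
    (k : ℕ) {f : CX} (hf : lineForm a b ^ k * f ∈ Ideal.span {P, Q}) : f ∈ Ideal.span {P, Q} := by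
  induction k generalizing f with
  | zero => simpa using hf
  | succ k ih =>
    refine ih (lineForm_mul_mem_span_pair a b hP hQ hD hV ?_)
    rwa [pow_succ', mul_assoc] at hf

end Roy2013

end Literature.NumberTheory.Transcendental
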